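import Mathlib
import Summits.Ventures.HodgeRepro2.Tier7.Line3.HeckeWindowIdeal

/-!
# Tier7/Line3/HeckeWindowSix — one of SIX fixed windows works, I: the abstract effective theorem
(REPAIR-CENSUS §C U1′ follow-up, effective form of Tier7/Line3/HeckeWindowIdeal (part IV); part VII =
Tier7/Line3/HeckeWindowSixOrb.lean: the order-4 recurrence of the model's `o_n = orbSum(n,0)` and THE THEOREM on the model)

Filer: t7-L1-p3 (gen 7, prover-pub-hodge-repro2-t7-L1-p3-g7-0), self-selected on the seat's own TARGET line (STATUS
l. 15780; twin window held). Lane: Line 3 SUPPORT, [M]-level (a kernel fact about the §2c MODEL that the dictionary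
then quotes); NOT a line, NOT a device; touches neither residual clause (a′) nor (b′) of the line.

WHAT IT SUPPLIES. Part IV proved `∃ n, W_n ≠ 0` for the windows `W_n = (e + c²) o_n − cκ o_{n+1} − c l_n e o_{n−1}` by a
growth argument (a limit; `n` not effective — crit-2's record (c), STATUS l. 15763). THIS FILE makes it effective under one
more hypothesis on the sequence, which the model satisfies (part VII): `(o_n)_{n ≥ 1}` obeys an ORDER-4 LINEAR RECURRENCE
with characteristic roots `ρ₁ … ρ₄` of modulus `1` (`Rec4`). Then `∃ n ≤ 5, W_n ≠ 0` — ONE OF THE SIX FIXED WINDOW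
FUNCTIONS `F_0, …, F_5` of part IV has non-zero orbital integral.

PROOF (`exists_le_five_windowSeq_ne_zero`). Suppose `W_0 = … = W_5 = 0`. With `λ₁ = c/κ`, `λ₂ = e/(cκ)` (modulus
`‖κ‖⁻¹ > 1`): `o_1 = λ₁ + λ₂`, `o_2 = (λ₁ + λ₂) o_1 − λ₁λ₂ − e`, `o_{k+1} = (λ₁ + λ₂) o_k − λ₁λ₂ o_{k−1}` for `2 ≤ k ≤ 5`.
The shifted differences `z_k = o_{k+1} − λ₁ o_k` (`1 ≤ k ≤ 5`) satisfy `z_{k+1} = λ₂ z_k`, and the order-4 recurrence at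
indices `1, 2` gives `z_5 − e₁ z_4 + e₂ z_3 − e₃ z_2 + e₄ z_1 = 0`, i.e. `z_1 · P(λ₂) = 0` with `P(X) = ∏ (X − ρᵢ)`; `P(λ₂) ≠ 0`
by modulus (`charPoly_ne_zero`), so `z_1 = 0`: `o_2 = λ₁ o_1`, and then `o_{k+1} = λ₁ o_k` for `k ≤ 4` (the 2-term recurrence
propagates it), so the order-4 recurrence at index `1` reads `o_1 · P(λ₁) = 0`, whence `o_1 = 0 = o_2`; but `W_1 = 0` then
says `λ₁λ₂ = −e`, against `‖λ₁λ₂‖ = ‖κ‖⁻² ≠ 1 = ‖e‖`. Everything is polynomial identities (`linear_combination`) plus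
the two modulus facts; no limit, no case split.

ALSO HERE (K10): `Rec4` and its algebra — `rec4_of_rec2` (a sequence with a 2-term recurrence of roots `ρ, σ` satisfies
`Rec4 ρ σ τ υ` for any `τ, υ`), `Rec4.of_esym_eq` (the recurrence depends on the roots only through their elementary
symmetric functions — reordering), `Rec4.add / sub / neg / of_eventually_eq` (assembling the four families of part VII).

NO TEMPEREDNESS AT `v₂` IS USED (plan-3 l. 15740 (4)): only `‖c‖ = 1`, `‖e‖ = 1` and `‖ρᵢ‖ = 1` enter.

NOT in this file (the dictionary, (a′), in words): Macdonald's formula, the Cartan model, the identification of the real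
objects and the unitarity prints (as in parts IV–V); anything about `X`; nothing about the step (P) is claimed.

§8(d) (uses an L-value-free non-vanishing device): NO — polynomial identities and two modulus comparisons.
-/

namespace Summit.Ventures.HodgeRepro2.Tier7.Line3.HeckeWindow

/-! ## K10. Order-4 linear recurrences with prescribed characteristic roots -/

/-- (K10) `e₁ = ρ₁ + ρ₂ + ρ₃ + ρ₄`. -/
def esym1 (ρ₁ ρ₂ ρ₃ ρ₄ : ℂ) : ℂ := ρ₁ + ρ₂ + ρ₃ + ρ₄

/-- (K10) `e₂ = Σ_{i<j} ρᵢ ρⱼ`. -/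
def esym2 (ρ₁ ρ₂ ρ₃ ρ₄ : ℂ) : ℂ :=
  ρ₁ * ρ₂ + ρ₁ * ρ₃ + ρ₁ * ρ₄ + ρ₂ * ρ₃ + ρ₂ * ρ₄ + ρ₃ * ρ₄

/-- (K10) `e₃ = Σ_{i<j<k} ρᵢ ρⱼ ρₖ`. -/
def esym3 (ρ₁ ρ₂ ρ₃ ρ₄ : ℂ) : ℂ :=
  ρ₁ * ρ₂ * ρ₃ + ρ₁ * ρ₂ * ρ₄ + ρ₁ * ρ₃ * ρ₄ + ρ₂ * ρ₃ * ρ₄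

/-- (K10) `e₄ = ρ₁ ρ₂ ρ₃ ρ₄`. -/
def esym4 (ρ₁ ρ₂ ρ₃ ρ₄ : ℂ) : ℂ := ρ₁ * ρ₂ * ρ₃ * ρ₄

/-- (K10) `f` satisfies the order-4 linear recurrence with characteristic polynomial `∏ (X − ρᵢ)` from index `n₀` on:
`f (n+4) − e₁ f (n+3) + e₂ f (n+2) − e₃ f (n+1) + e₄ f n = 0` for all `n ≥ n₀`. -/
def Rec4 (ρ₁ ρ₂ ρ₃ ρ₄ : ℂ) (f : ℕ → ℂ) (n₀ : ℕ) : Prop :=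
  ∀ n, n₀ ≤ n → f (n + 4) - esym1 ρ₁ ρ₂ ρ₃ ρ₄ * f (n + 3) + esym2 ρ₁ ρ₂ ρ₃ ρ₄ * f (n + 2) -
    esym3 ρ₁ ρ₂ ρ₃ ρ₄ * f (n + 1) + esym4 ρ₁ ρ₂ ρ₃ ρ₄ * f n = 0

/-- (K10) The characteristic polynomial factors: `λ⁴ − e₁ λ³ + e₂ λ² − e₃ λ + e₄ = ∏ (λ − ρᵢ)`. -/
theorem charPoly_eq (ρ₁ ρ₂ ρ₃ ρ₄ l : ℂ) :
    l ^ 4 - esym1 ρ₁ ρ₂ ρ₃ ρ₄ * l ^ 3 + esym2 ρ₁ ρ₂ ρ₃ ρ₄ * l ^ 2 - esym3 ρ₁ ρ₂ ρ₃ ρ₄ * l +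
      esym4 ρ₁ ρ₂ ρ₃ ρ₄ = (l - ρ₁) * (l - ρ₂) * (l - ρ₃) * (l - ρ₄) := by
  simp only [esym1, esym2, esym3, esym4]; ring

/-- (K10) `∏ (λ − ρᵢ) ≠ 0` when `‖λ‖ > 1 = ‖ρᵢ‖`. -/
theorem charPoly_ne_zero (ρ₁ ρ₂ ρ₃ ρ₄ l : ℂ) (h₁ : ‖ρ₁‖ = 1) (h₂ : ‖ρ₂‖ = 1) (h₃ : ‖ρ₃‖ = 1)
    (h₄ : ‖ρ₄‖ = 1) (hl : 1 < ‖l‖) : (l - ρ₁) * (l - ρ₂) * (l - ρ₃) * (l - ρ₄) ≠ 0 := by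
  have key : ∀ ρ : ℂ, ‖ρ‖ = 1 → l - ρ ≠ 0 := by
    intro ρ hρ h
    rw [sub_eq_zero.mp h, hρ] at hl
    exact lt_irrefl _ hl
  exact mul_ne_zero (mul_ne_zero (mul_ne_zero (key _ h₁) (key _ h₂)) (key _ h₃)) (key _ h₄)

/-- (K10) A sequence with the 2-term recurrence `f (n+2) = (ρ + σ) f (n+1) − ρσ f n` satisfies `Rec4 ρ σ τ υ` for any
`τ, υ` (`(X−ρ)(X−σ)` divides `(X−ρ)(X−σ)(X−τ)(X−υ)`). -/
theorem rec4_of_rec2 (ρ σ τ υ : ℂ) (f : ℕ → ℂ)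
    (h : ∀ n, f (n + 2) = (ρ + σ) * f (n + 1) - ρ * σ * f n) : Rec4 ρ σ τ υ f 0 := by
  intro n _
  have h0 := h n
  have h1 : f (n + 3) = (ρ + σ) * f (n + 2) - ρ * σ * f (n + 1) := h (n + 1)
  have h2 : f (n + 4) = (ρ + σ) * f (n + 3) - ρ * σ * f (n + 2) := h (n + 2)
  simp only [esym1, esym2, esym3, esym4]
  linear_combination h2 - (τ + υ) * h1 + τ * υ * h0

/-- (K10) The recurrence depends on the roots only through `e₁ … e₄` (reordering the roots). -/
theorem Rec4.of_esym_eq {ρ₁ ρ₂ ρ₃ ρ₄ σ₁ σ₂ σ₃ σ₄ : ℂ} {f : ℕ → ℂ} {n₀ : ℕ}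
    (h : Rec4 ρ₁ ρ₂ ρ₃ ρ₄ f n₀) (h1 : esym1 ρ₁ ρ₂ ρ₃ ρ₄ = esym1 σ₁ σ₂ σ₃ σ₄)
    (h2 : esym2 ρ₁ ρ₂ ρ₃ ρ₄ = esym2 σ₁ σ₂ σ₃ σ₄) (h3 : esym3 ρ₁ ρ₂ ρ₃ ρ₄ = esym3 σ₁ σ₂ σ₃ σ₄)
    (h4 : esym4 ρ₁ ρ₂ ρ₃ ρ₄ = esym4 σ₁ σ₂ σ₃ σ₄) : Rec4 σ₁ σ₂ σ₃ σ₄ f n₀ := by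
  intro n hn
  have := h n hn
  rw [h1, h2, h3, h4] at this
  exact this

/-- (K10) Sums of solutions are solutions. -/
theorem Rec4.add {ρ₁ ρ₂ ρ₃ ρ₄ : ℂ} {f g : ℕ → ℂ} {n₀ : ℕ} (hf : Rec4 ρ₁ ρ₂ ρ₃ ρ₄ f n₀)
    (hg : Rec4 ρ₁ ρ₂ ρ₃ ρ₄ g n₀) : Rec4 ρ₁ ρ₂ ρ₃ ρ₄ (fun n => f n + g n) n₀ := by
  intro n hn
  have := hf n hn
  have := hg n hn
  linear_combination this + ‹f (n + 4) - _ * f (n + 3) + _ * f (n + 2) - _ * f (n + 1) + _ * f n = 0›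

/-- (K10) Differences of solutions are solutions. -/
theorem Rec4.sub {ρ₁ ρ₂ ρ₃ ρ₄ : ℂ} {f g : ℕ → ℂ} {n₀ : ℕ} (hf : Rec4 ρ₁ ρ₂ ρ₃ ρ₄ f n₀)
    (hg : Rec4 ρ₁ ρ₂ ρ₃ ρ₄ g n₀) : Rec4 ρ₁ ρ₂ ρ₃ ρ₄ (fun n => f n - g n) n₀ := by
  intro n hn
  have h1 := hf n hn
  have h2 := hg n hn
  linear_combination h1 - h2

/-- (K10) A sequence agreeing with a solution from index `n₀` on is a solution from `n₀` on. -/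
theorem Rec4.of_eventually_eq {ρ₁ ρ₂ ρ₃ ρ₄ : ℂ} {f g : ℕ → ℂ} {n₀ : ℕ} (hf : Rec4 ρ₁ ρ₂ ρ₃ ρ₄ f n₀)
    (hfg : ∀ n, n₀ ≤ n → g n = f n) : Rec4 ρ₁ ρ₂ ρ₃ ρ₄ g n₀ := by
  intro n hn
  rw [hfg n hn, hfg (n + 1) (by omega), hfg (n + 2) (by omega), hfg (n + 3) (by omega),
    hfg (n + 4) (by omega)]
  exact hf n hn

/-- (K10) Geometric sequences `r^n` satisfy the 2-term recurrence with roots `r, s` for any `s`. -/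
theorem pow_rec2 (r s : ℂ) (n : ℕ) : r ^ (n + 2) = (r + s) * r ^ (n + 1) - r * s * r ^ n := by ring

/-! ## K11. THE EFFECTIVE THEOREM: one of `W_0, …, W_5` is non-zero -/

/-- (K11) THE EFFECTIVE THEOREM. If `o_0 = 1` and `(o_n)_{n ≥ 1}` satisfies `Rec4 ρ₁ ρ₂ ρ₃ ρ₄` with `‖ρᵢ‖ = 1`, then for
unitary `e`, `c` and `0 < ‖κ‖ < 1` one of the six windows `W_0, …, W_5` is non-zero. -/
theorem exists_le_five_windowSeq_ne_zero (o : ℕ → ℂ) (e c κ ρ₁ ρ₂ ρ₃ ρ₄ : ℂ) (h0 : o 0 = 1)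
    (hrec : Rec4 ρ₁ ρ₂ ρ₃ ρ₄ o 1) (h₁ : ‖ρ₁‖ = 1) (h₂ : ‖ρ₂‖ = 1) (h₃ : ‖ρ₃‖ = 1) (h₄ : ‖ρ₄‖ = 1)
    (he : ‖e‖ = 1) (hc : ‖c‖ = 1) (hκ0 : κ ≠ 0) (hκ : ‖κ‖ < 1) :
    ∃ n, n ≤ 5 ∧ windowSeq o e c κ n ≠ 0 := by
  by_contra hall
  push Not at hall
  have hc0 : c ≠ 0 := by
    intro h; rw [h, norm_zero] at hc; exact zero_ne_one hc
  have hκpos : 0 < ‖κ‖ := norm_pos_iff.mpr hκ0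
  have hgt : 1 < ‖κ‖⁻¹ := (one_lt_inv₀ hκpos).mpr hκ
  have hcκ : c * κ ≠ 0 := mul_ne_zero hc0 hκ0
  set l₁ : ℂ := c / κ with hl₁
  set l₂ : ℂ := e / (c * κ) with hl₂
  have hnl₁ : ‖l₁‖ = ‖κ‖⁻¹ := by rw [hl₁, norm_div, hc, one_div]
  have hnl₂ : ‖l₂‖ = ‖κ‖⁻¹ := by rw [hl₂, norm_div, norm_mul, he, hc, one_mul, one_div]
  have hl₁' : c * κ * l₁ = c ^ 2 := by rw [hl₁, mul_div_assoc', div_eq_iff hκ0]; ring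
  have hl₂' : c * κ * l₂ = e := by rw [hl₂, mul_div_assoc', div_eq_iff hcκ]; ring
  -- the six relations
  have r1 : o 2 = (l₁ + l₂) * o 1 - l₁ * l₂ - e := by
    have h := hall 1 (by norm_num)
    simp only [windowSeq, lowCoeff, h0, mul_one, show (1 : ℕ) + 1 = 2 from rfl,
      show (1 : ℕ) - 1 = 0 from rfl] at h
    apply mul_left_cancel₀ hcκ
    have hκinv : κ * κ⁻¹ = 1 := mul_inv_cancel₀ hκ0
    linear_combination -h - (o 1) * hl₁' + (-(o 1) + l₁) * hl₂' - (c * κ * e) * hκinv + e * hl₁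
  have rk : ∀ k, k ≤ 3 → o (k + 3) = (l₁ + l₂) * o (k + 2) - l₁ * l₂ * o (k + 1) := by
    intro k hk
    have h := hall (k + 2) (by omega)
    simp only [windowSeq, lowCoeff, show k + 2 + 1 = k + 3 from rfl,
      show k + 2 - 1 = k + 1 from rfl] at h
    apply mul_left_cancel₀ hcκ
    linear_combination -h - (o (k + 2)) * hl₁' + (-(o (k + 2)) + l₁ * o (k + 1)) * hl₂' +
      (o (k + 1) * e) * hl₁
  have r2 : o 3 = (l₁ + l₂) * o 2 - l₁ * l₂ * o 1 := rk 0 (by norm_num)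
  have r3 : o 4 = (l₁ + l₂) * o 3 - l₁ * l₂ * o 2 := rk 1 (by norm_num)
  have r4 : o 5 = (l₁ + l₂) * o 4 - l₁ * l₂ * o 3 := rk 2 (by norm_num)
  have r5 : o 6 = (l₁ + l₂) * o 5 - l₁ * l₂ * o 4 := rk 3 (by norm_num)
  -- the order-4 recurrence at indices 1 and 2
  have hP1 := hrec 1 (le_refl 1)
  have hP2 := hrec 2 (by norm_num)
  simp only [show (1 : ℕ) + 4 = 5 from rfl, show (1 : ℕ) + 3 = 4 from rfl,
    show (1 : ℕ) + 2 = 3 from rfl, show (1 : ℕ) + 1 = 2 from rfl] at hP1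
  simp only [show (2 : ℕ) + 4 = 6 from rfl, show (2 : ℕ) + 3 = 5 from rfl,
    show (2 : ℕ) + 2 = 4 from rfl, show (2 : ℕ) + 1 = 3 from rfl] at hP2
  -- the shifted differences `z′_k = o_{k+1} − λ₁ o_k` are geometric of ratio `λ₂`: `z′₁ · P(λ₂) = 0`
  have hPl₁ := charPoly_ne_zero ρ₁ ρ₂ ρ₃ ρ₄ l₁ h₁ h₂ h₃ h₄ (by rw [hnl₁]; exact hgt)
  have hPl₂ := charPoly_ne_zero ρ₁ ρ₂ ρ₃ ρ₄ l₂ h₁ h₂ h₃ h₄ (by rw [hnl₂]; exact hgt)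
  have hz' : (o 2 - l₁ * o 1) * ((l₂ - ρ₁) * (l₂ - ρ₂) * (l₂ - ρ₃) * (l₂ - ρ₄)) = 0 := by
    rw [← charPoly_eq]
    have hz2 : o 3 - l₁ * o 2 = l₂ * (o 2 - l₁ * o 1) := by linear_combination r2
    have hz3 : o 4 - l₁ * o 3 = l₂ * (o 3 - l₁ * o 2) := by linear_combination r3
    have hz4 : o 5 - l₁ * o 4 = l₂ * (o 4 - l₁ * o 3) := by linear_combination r4
    have hz5 : o 6 - l₁ * o 5 = l₂ * (o 5 - l₁ * o 4) := by linear_combination r5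
    linear_combination hP2 - l₁ * hP1 - (hz5 + l₂ * hz4 + l₂ ^ 2 * hz3 + l₂ ^ 3 * hz2) +
      esym1 ρ₁ ρ₂ ρ₃ ρ₄ * (hz4 + l₂ * hz3 + l₂ ^ 2 * hz2) -
      esym2 ρ₁ ρ₂ ρ₃ ρ₄ * (hz3 + l₂ * hz2) + esym3 ρ₁ ρ₂ ρ₃ ρ₄ * hz2
  have hw0' : o 2 - l₁ * o 1 = 0 := (mul_eq_zero.mp hz').resolve_right hPl₂
  -- hence `o` is geometric of ratio `λ₁` on `1 … 5`, and the recurrence at index `1` gives `o 1 · P(λ₁) = 0`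
  have g2 : o 2 = l₁ * o 1 := by linear_combination hw0'
  have g3 : o 3 = l₁ * o 2 := by linear_combination r2 + l₂ * g2
  have g4 : o 4 = l₁ * o 3 := by linear_combination r3 + l₂ * g3
  have g5 : o 5 = l₁ * o 4 := by linear_combination r4 + l₂ * g4
  have hgeo : o 1 * ((l₁ - ρ₁) * (l₁ - ρ₂) * (l₁ - ρ₃) * (l₁ - ρ₄)) = 0 := by
    rw [← charPoly_eq]
    linear_combination hP1 - (g5 + l₁ * g4 + l₁ ^ 2 * g3 + l₁ ^ 3 * g2) +
      esym1 ρ₁ ρ₂ ρ₃ ρ₄ * (g4 + l₁ * g3 + l₁ ^ 2 * g2) - esym2 ρ₁ ρ₂ ρ₃ ρ₄ * (g3 + l₁ * g2) +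
      esym3 ρ₁ ρ₂ ρ₃ ρ₄ * g2
  have ho1 : o 1 = 0 := (mul_eq_zero.mp hgeo).resolve_right hPl₁
  -- `o 1 = o 2 = 0` forces `λ₁ λ₂ = −e`, impossible in modulus
  have h2 : o 2 = 0 := by rw [g2, ho1, mul_zero]
  have hprod : l₁ * l₂ = -e := by rw [ho1, h2] at r1; linear_combination r1
  have hn : ‖l₁ * l₂‖ = ‖κ‖⁻¹ * ‖κ‖⁻¹ := by rw [norm_mul, hnl₁, hnl₂]
  rw [hprod, norm_neg, he] at hn
  nlinarith [hgt]

end Summit.Ventures.HodgeRepro2.Tier7.Line3.HeckeWindow
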